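import Mathlib
import Literature.AlgebraicGeometry.Motives.SubschemeCycles
import Literature.AlgebraicGeometry.Motives.BaseChange
import Literature.AlgebraicGeometry.Motives.GenericFibreRatSpread
import Literature.AlgebraicGeometry.Motives.SubschemeCyclesCodimProofs
import Literature.AlgebraicGeometry.Motives.AlgPointsProductProofs
import Literature.AlgebraicGeometry.Morphisms.GenericFibreSmooth
import Literature.AlgebraicGeometry.Motives.SmoothSpread
import Literature.AlgebraicGeometry.Motives.ProjectiveDescentProofs
import Literature.AlgebraicGeometry.HodgeTheory.SpreadingOutQbarFamilyProofs
import Literature.AlgebraicGeometry.HodgeTheory.HodgeGenericQbarDescentCompactification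
import HarnessLib

/-!
# Algebraic cycles on `X₀ ⊗_σ ℂ` are supported over `ℚ̄`: the spread of a subvariety, I (the generic fibre)

Topic `Literature/AlgebraicGeometry/HodgeTheory` (family `hodge`). Theorems only (no definitions,
no named facts; D-0026). First file of the GEOMETRIC half of the discharge of the named fact
`charlesSchnell2014_algebraicClasses_supportedOn_qbarClosed` (`AlgebraicCyclesDefinedOverQbar.lean`;
Charles–Schnell, *Notes on absolute Hodge classes*, Remark after Cor. 11.3.16; Fulton §19.1/§19.3),
whose topological half (`charlesSchnell2014_…_of_spreadClass`, `exists_spreadClass_of_resolution`)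
reduces it to SPREADING a closed irreducible `V ⊆ X = X₀ ⊗_σ ℂ` of codimension `p` over a smooth
projective `ℚ̄`-variety `T₀`: a closed `𝒱̄₀ ⊆ X₀ ⊗ T₀` and a `ℚ̄`-generic complex point `t` of
`T = T₀ ⊗_σ ℂ` with `i_t⁻¹ 𝒱̄ = V`, together with a resolution of `𝒱̄₀` and the dimension count
`dim 𝒱̄₀ = dim V + dim T₀`. The printed argument ("`Z` corresponds to a point in some product of
Hilbert schemes … defined over `k`") is replaced, on the tree's carriers, by the `ℚ̄`-Zariski
closure `𝒱̄₀ = cl Φ_t(V)` of `V` under the slice-then-project map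
`Φ_t : X -i_t→ X ⊗ T ≅ (X₀ ⊗ T₀) ⊗_σ ℂ -π→ X₀ ⊗ T₀` at a generic parameter. This file supplies:

* `sliceAt_comp_baseChangeHomFst_comp_fst/snd` — the two components of `Φ_t` for an ARBITRARY
  complex point `t` (`π_{X₀}` and the constant map through `Spec ℂ -t→ T -π→ T₀`);
* `isPullback_lift_sliceProjection` — **`Φ_t` factors through every base change `S → T₀` through
  which the parameter factors, by a CARTESIAN square** (for `S = Spec K(T₀)`: `Φ_t = Φ ≫ j` with
  `j` the generic fibre of `X₀ ⊗ T₀ → T₀` and `Φ` a base change of `Spec ℂ → Spec K(T₀)`);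
* `coheight_eq_coheight_apply_of_forall_specializes`,
  `coheight_eq_coheight_apply_of_isGenericPoint_preimage` — flat maps preserve the codimension of
  points maximal in their fibre, e.g. of the generic point of a saturated closed set (the flat
  dimension formula, Hartshorne III Prop. 9.5, tree `Motives.coheight_eq_coheight_add_coheight_asFiber`);
* `coheight_sliceProjection_apply_eq` — **for `t` over the generic point of `T₀` and
  `V = Φ_t⁻¹ Z` with generic point `η`, `codim_{X₀ ⊗ T₀} Φ_t(η) = codim_X η`** (the dimension
  count `dim 𝒱̄₀ = dim V + dim T₀` for the `ℚ̄`-closure of a subvariety defined over `K(T₀) ↪ ℂ`);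
* `smoothOfRelativeDimension_hom_of_baseChangeHom`, `isSmoothProjective_of_baseChangeHom` —
  **"smooth projective of dimension `n`" descends along `σ : K →+* L`** (fpqc descent of
  smoothness, relative dimension read off after base change, Görtz–Wedhorn I Prop. 14.57 for
  projectivity — the tree's `Motives.IsProjectiveOver.of_baseChange_holds` — and descent of
  geometric irreducibility), so that the given `ℚ̄`-structure `X₀` is itself smooth projective.

## References

* [CharlesSchnell2014Notes] F. Charles, C. Schnell, Notes on absolute Hodge classes (2014),
  Remark after Cor. 11.3.16; Lemma 11.3.14.
* [Fulton1998] W. Fulton, Intersection Theory (1998), §10.1, §19.1, Example 19.1.10.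
* [Hartshorne1977] R. Hartshorne, Algebraic Geometry (1977), II.3 Thm. 3.3, II Ex. 3.20,
  III Prop. 9.5, III.10.1.
* [GortzWedhorn2020] U. Görtz, T. Wedhorn, Algebraic Geometry I, 2nd ed. (2020), Prop. 14.57.
* [StacksProject] The Stacks Project, Tags 02G2, 0C0C (relative dimension), 01V9.
-/

noncomputable section

open CategoryTheory CategoryTheory.Limits AlgebraicGeometry
open MonoidalCategory CartesianMonoidalCategory

namespace Literature.AlgebraicGeometry.HodgeTheory

open Literature.AlgebraicGeometry.Motives

universe u

section SliceProjection

variable {K L : Type u} [Field K] [Field L] (σ : K →+* L)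

/-- **The two components of the slice-then-project map** `Φ_t : X₀_σ -i_t→ X₀_σ ⊗ T₀_σ ≅ (X₀ ⊗ T₀)_σ -π→ X₀ ⊗ T₀`
at an ARBITRARY `L`-point `t` of `T₀_σ`: on the first factor `Φ_t` is the projection `π_{X₀}`, on
the second it is the constant map `X₀_σ → Spec L -t→ T₀_σ -π→ T₀` (test the product comparison `e`
against the projections; Hartshorne II.3 Thm. 3.3). [cite: Hartshorne1977, II.3 Thm. 3.3] -/
theorem sliceAt_comp_baseChangeHomFst_comp_fst (X₀ T₀ : SchemeOver K)
    (t : AlgPoints ((baseChangeHom σ).obj T₀) L)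
    (e : (baseChangeHom σ).obj X₀ ⊗ (baseChangeHom σ).obj T₀ ≅ (baseChangeHom σ).obj (X₀ ⊗ T₀))
    (he₁ : e.hom ≫ (baseChangeHom σ).map (fst X₀ T₀) = fst _ _) :
    ((sliceAt ((baseChangeHom σ).obj X₀) t).left ≫ e.hom.left ≫ baseChangeHomFst σ (X₀ ⊗ T₀)) ≫
        (fst X₀ T₀).left = baseChangeHomFst σ X₀ := by
  rw [Category.assoc, Category.assoc, ← baseChangeHom_map_left_comp_fst σ (fst X₀ T₀),
    ← Category.assoc e.hom.left, ← Over.comp_left, he₁, ← Category.assoc, ← Over.comp_left,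
    sliceAt_fst, Over.id_left, Category.id_comp]

/-- Second component of `Φ_t`, see `sliceAt_comp_baseChangeHomFst_comp_fst`. [cite: Hartshorne1977, II.3 Thm. 3.3] -/
theorem sliceAt_comp_baseChangeHomFst_comp_snd (X₀ T₀ : SchemeOver K)
    (t : AlgPoints ((baseChangeHom σ).obj T₀) L)
    (e : (baseChangeHom σ).obj X₀ ⊗ (baseChangeHom σ).obj T₀ ≅ (baseChangeHom σ).obj (X₀ ⊗ T₀))
    (he₂ : e.hom ≫ (baseChangeHom σ).map (snd X₀ T₀) = snd _ _) :
    ((sliceAt ((baseChangeHom σ).obj X₀) t).left ≫ e.hom.left ≫ baseChangeHomFst σ (X₀ ⊗ T₀)) ≫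
        (snd X₀ T₀).left =
      ((baseChangeHom σ).obj X₀).hom ≫ t.left ≫ baseChangeHomFst σ T₀ := by
  have h3 : (sliceAt ((baseChangeHom σ).obj X₀) t).left ≫
      (snd ((baseChangeHom σ).obj X₀) ((baseChangeHom σ).obj T₀)).left =
        ((baseChangeHom σ).obj X₀).hom ≫ t.left := by
    rw [← Over.comp_left, sliceAt_snd, Over.comp_left, toSpecOver_left]
    rfl
  rw [Category.assoc, Category.assoc, ← baseChangeHom_map_left_comp_fst σ (snd X₀ T₀),
    ← Category.assoc e.hom.left, ← Over.comp_left, he₂, ← Category.assoc, h3, Category.assoc]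

/-- The `K`-morphism `Spec L -t→ T₀_σ -π→ T₀` underlying an `L`-point of `T₀_σ` lies over
`Spec σ : Spec L → Spec K`. [folklore] -/
theorem algPoint_left_comp_baseChangeHomFst_comp_hom (T₀ : SchemeOver K)
    (t : AlgPoints ((baseChangeHom σ).obj T₀) L) :
    (t.left ≫ baseChangeHomFst σ T₀) ≫ T₀.hom = Spec.map (CommRingCat.ofHom σ) := by
  have ht : t.left ≫ ((baseChangeHom σ).obj T₀).hom = 𝟙 _ := by
    rw [Over.w t]
    change Spec.map (CommRingCat.ofHom (algebraMap L L)) = 𝟙 _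
    rw [Algebra.algebraMap_self, CommRingCat.ofHom_id, Spec.map_id]
  have hc : baseChangeHomFst σ T₀ ≫ T₀.hom =
      ((baseChangeHom σ).obj T₀).hom ≫ Spec.map (CommRingCat.ofHom σ) := pullback.condition
  rw [Category.assoc, hc, ← Category.assoc, ht]
  exact Category.id_comp _

end SliceProjection

/-! ### Codimension is unchanged at a point which is maximal in its fibre (flat dimension formula) -/

section Codimension

/-- **Flat maps preserve the codimension of points which are maximal in their fibre.** For a flat
morphism `f : P → Q` of locally Noetherian schemes and a point `x` admitting no proper
generization inside its fibre, `codim x = codim f(x)` (the flat dimension formula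
`codim x = codim f(x) + codim_{fibre} x`, Hartshorne III Prop. 9.5, the tree's
`Motives.coheight_eq_coheight_add_coheight_asFiber`, with vanishing last term).
[cite: Hartshorne1977, III Prop. 9.5] -/
theorem coheight_eq_coheight_apply_of_forall_specializes {P Q : Scheme.{u}} (f : P ⟶ Q) [Flat f]
    [IsLocallyNoetherian P] [IsLocallyNoetherian Q] (x : P)
    (hx : ∀ y : P, f.base y = f.base x → y ⤳ x → y = x) :
    Order.coheight x = Order.coheight (f.base x) := by
  have hmax : IsMax (f.asFiber x) := by
    intro y' hy'
    set y : P := (f.fiberι (f.base x)).base y' with hy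
    have hyS : f.base y = f.base x := by
      have hmem : y ∈ Set.range (f.fiberι (f.base x)).base := ⟨y', rfl⟩
      rw [Scheme.Hom.range_fiberι] at hmem
      exact hmem
    have hspec : y ⤳ x := by
      have h1 : y' ⤳ f.asFiber x := Scheme.le_iff_specializes.1 hy'
      have h2 := h1.map (f.fiberι (f.base x)).base.hom.continuous
      rwa [show (f.fiberι (f.base x)).base.hom (f.asFiber x) = x from f.fiberι_asFiber x] at h2
    have hyx : y = x := hx y hyS hspec
    have hinj := (f.fiberι (f.base x)).isEmbedding.injective
    have hy'x : y' = f.asFiber x := hinj (by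
      change y = (f.fiberι (f.base x)).base (f.asFiber x)
      rw [hyx]
      exact (f.fiberι_asFiber x).symm)
    rw [hy'x]
  have hform := Motives.coheight_eq_coheight_add_coheight_asFiber f x
  rwa [Order.coheight_eq_zero.2 hmax, add_zero] at hform

/-- **The generic point of a saturated closed set keeps its codimension downstairs**: if
`V = f⁻¹(C)` (any set `C`) has generic point `η` and `f` is flat between locally Noetherian schemes,
then `codim η = codim f(η)` — a point of the fibre of `f(η)` specializing to `η` lies in `V`, hence is
`η`. [cite: Hartshorne1977, III Prop. 9.5] -/
theorem coheight_eq_coheight_apply_of_isGenericPoint_preimage {P Q : Scheme.{u}} (f : P ⟶ Q) [Flat f]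
    [IsLocallyNoetherian P] [IsLocallyNoetherian Q] {C : Set Q} {η : P}
    (hη : IsGenericPoint η (f.base ⁻¹' C)) :
    Order.coheight η = Order.coheight (f.base η) := by
  refine coheight_eq_coheight_apply_of_forall_specializes f η fun y hy hyη ↦ ?_
  have hyV : y ∈ f.base ⁻¹' C := by
    rw [Set.mem_preimage, hy]
    exact hη.mem
  exact (hyη.antisymm (hη.specializes hyV)).eq

end Codimension

/-! ### The generic fibre factorisation and its cartesian square -/

section GenericFibre

variable {K L : Type u} [Field K] [Field L] (σ : K →+* L)

/-- **The slice-then-project map factors through any base change `S → T₀` through which the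
parameter point factors, by a CARTESIAN square.** Let `t` be an `L`-point of `T₀_σ` whose
`K`-morphism `Spec L → T₀` factors as `τ' ≫ i` through `i : S → T₀` (in the application `i` is the
generic point `Spec K(T₀) → T₀` and `t` is `ℚ̄`-generic). With `X_S := (X₀ ⊗ T₀) ×_{T₀} S -j→ X₀ ⊗ T₀`
the base change and `Φ : X₀_σ → X_S` the induced map (`Φ ≫ j = Φ_t`), the square
`(Φ, X₀_σ → Spec L; X_S → S, τ')` is cartesian: both `X₀_σ` and `X_S ×_S Spec L` are
`X₀ ×_K Spec L` (transitivity of fibre products, Hartshorne II.3 Thm. 3.3).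
[cite: Hartshorne1977, II.3 Thm. 3.3] -/
theorem isPullback_lift_sliceProjection (X₀ T₀ : SchemeOver K)
    (t : AlgPoints ((baseChangeHom σ).obj T₀) L)
    (e : (baseChangeHom σ).obj X₀ ⊗ (baseChangeHom σ).obj T₀ ≅ (baseChangeHom σ).obj (X₀ ⊗ T₀))
    (he₁ : e.hom ≫ (baseChangeHom σ).map (fst X₀ T₀) = fst _ _)
    (he₂ : e.hom ≫ (baseChangeHom σ).map (snd X₀ T₀) = snd _ _)
    {S : Scheme.{u}} (i : S ⟶ T₀.left) (τ' : Spec (.of L) ⟶ S)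
    (hτ : τ' ≫ i = t.left ≫ baseChangeHomFst σ T₀) :
    ∃ Φ : ((baseChangeHom σ).obj X₀).left ⟶ pullback (snd X₀ T₀).left i,
      Φ ≫ pullback.fst _ _ =
          (sliceAt ((baseChangeHom σ).obj X₀) t).left ≫ e.hom.left ≫ baseChangeHomFst σ (X₀ ⊗ T₀) ∧
        IsPullback Φ ((baseChangeHom σ).obj X₀).hom (pullback.snd _ _) τ' := by
  have hsnd : ((sliceAt ((baseChangeHom σ).obj X₀) t).left ≫ e.hom.left ≫
      baseChangeHomFst σ (X₀ ⊗ T₀)) ≫ (snd X₀ T₀).left =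
        (((baseChangeHom σ).obj X₀).hom ≫ τ') ≫ i := by
    rw [sliceAt_comp_baseChangeHomFst_comp_snd σ X₀ T₀ t e he₂, Category.assoc, hτ]
    rfl
  refine ⟨pullback.lift _ _ hsnd, pullback.lift_fst _ _ _, ?_⟩
  -- the right-hand square `X_S → X₀` over `S → Spec K` is cartesian (pasting)
  have hP : IsPullback (fst X₀ T₀).left (snd X₀ T₀).left X₀.hom T₀.hom :=
    IsPullback.of_hasPullback X₀.hom T₀.hom
  have hS : IsPullback (pullback.fst (snd X₀ T₀).left i) (pullback.snd (snd X₀ T₀).left i)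
      (snd X₀ T₀).left i :=
    IsPullback.of_hasPullback _ _
  have hright : IsPullback (pullback.fst (snd X₀ T₀).left i ≫ (fst X₀ T₀).left)
      (pullback.snd (snd X₀ T₀).left i) X₀.hom (i ≫ T₀.hom) :=
    hS.paste_horiz hP
  -- the outer square is the defining square of `X₀_σ`
  have h1 : pullback.lift _ _ hsnd ≫ (pullback.fst (snd X₀ T₀).left i ≫ (fst X₀ T₀).left) =
      baseChangeHomFst σ X₀ := by
    rw [← Category.assoc, pullback.lift_fst]
    exact sliceAt_comp_baseChangeHomFst_comp_fst σ X₀ T₀ t e he₁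
  have h2 : τ' ≫ (i ≫ T₀.hom) = Spec.map (CommRingCat.ofHom σ) := by
    rw [← Category.assoc, hτ]
    exact algPoint_left_comp_baseChangeHomFst_comp_hom σ T₀ t
  have houter : IsPullback (pullback.lift _ _ hsnd ≫ (pullback.fst (snd X₀ T₀).left i ≫ (fst X₀ T₀).left))
      ((baseChangeHom σ).obj X₀).hom X₀.hom (τ' ≫ (i ≫ T₀.hom)) := by
    rw [h1, h2]
    exact IsPullback.of_hasPullback X₀.hom (Spec.map (CommRingCat.ofHom σ))
  exact houter.of_right (pullback.lift_snd _ _ _) hright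

/-- A base change of `Spec L → Spec A`, `A` a field, is flat and surjective. [folklore] -/
theorem flat_surjective_of_isPullback_specMap {X XS : Scheme.{u}} {A : CommRingCat.{u}}
    (hA : IsField A) (Φ : X ⟶ XS) (p : X ⟶ Spec (.of L)) (q : XS ⟶ Spec A)
    (φ : A ⟶ CommRingCat.of L) (H : IsPullback Φ p q (Spec.map φ)) : Flat Φ ∧ Surjective Φ := by
  letI := hA.toField
  haveI : Subsingleton ↥(Spec A) := inferInstanceAs (Subsingleton (PrimeSpectrum A))
  haveI : Surjective (Spec.map φ) :=
    ⟨fun x ↦ ⟨(default : ↥(Spec (CommRingCat.of L))), Subsingleton.elim _ _⟩⟩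
  haveI : Flat (Spec.map φ) := by
    rw [HasRingHomProperty.Spec_iff (P := @Flat)]
    letI := φ.hom.toAlgebra
    change Module.Flat A L
    infer_instance
  exact ⟨MorphismProperty.of_isPullback (P := @Flat) H.flip inferInstance,
    MorphismProperty.of_isPullback (P := @Surjective) H.flip inferInstance⟩

/-- **Codimension of the generic point of a subvariety "defined over `K(T₀)` through a generic
parameter".** Let `t` be an `L`-point of `T₀_σ` over the GENERIC point of the integral `T₀`
(`π_{T₀}(t) = η_{T₀}`), `Φ_t : X₀_σ → X₀ ⊗ T₀` the slice-then-project map, and `V = Φ_t⁻¹ Z` a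
saturated subset with generic point `η`. Then `codim_{X₀ ⊗ T₀} Φ_t(η) = codim_{X₀_σ} η`: `Φ_t`
factors as `X₀_σ -Φ→ X₀ ⊗_K Spec K(T₀) -j→ X₀ ⊗ T₀` with `Φ` flat (a base change of
`Spec L → Spec K(T₀)`, `isPullback_lift_sliceProjection`) and `j` a flat preimmersion (the generic
fibre), `η` is maximal in its `Φ`-fibre (flat dimension formula,
`coheight_eq_coheight_apply_of_isGenericPoint_preimage`) and `j` preserves codimension
(`Motives.coheight_apply_of_flat_of_isPreimmersion`). This is the dimension count
"`dim 𝒱̄ = dim V + dim T`" for the `ℚ̄`-Zariski closure `𝒱̄ = cl Φ_t(V)` of a subvariety `V`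
defined over `K(T₀) ↪ ℂ`. [cite: Hartshorne1977, III Prop. 9.5 and II Ex. 3.20] -/
theorem coheight_sliceProjection_apply_eq (X₀ T₀ : SchemeOver K) [IsIntegral T₀.left]
    [LocallyOfFiniteType X₀.hom] (t : AlgPoints ((baseChangeHom σ).obj T₀) L)
    (ht : (baseChangeHomFst σ T₀).base t.pt = genericPoint T₀.left)
    (e : (baseChangeHom σ).obj X₀ ⊗ (baseChangeHom σ).obj T₀ ≅ (baseChangeHom σ).obj (X₀ ⊗ T₀))
    (he₁ : e.hom ≫ (baseChangeHom σ).map (fst X₀ T₀) = fst _ _)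
    (he₂ : e.hom ≫ (baseChangeHom σ).map (snd X₀ T₀) = snd _ _)
    {Z : Set (X₀ ⊗ T₀).left} {η : ((baseChangeHom σ).obj X₀).left}
    (hη : IsGenericPoint η (((sliceAt ((baseChangeHom σ).obj X₀) t).left ≫ e.hom.left ≫
      baseChangeHomFst σ (X₀ ⊗ T₀)).base ⁻¹' Z)) :
    Order.coheight (((sliceAt ((baseChangeHom σ).obj X₀) t).left ≫ e.hom.left ≫
        baseChangeHomFst σ (X₀ ⊗ T₀)).base η) = Order.coheight η := by
  -- the factorisation of `Spec L → T₀` through `Spec K(T₀)` (generic point)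
  have hfac := Scheme.descResidueField_stalkClosedPointTo_fromSpecResidueField L T₀.left
    (t.left ≫ baseChangeHomFst σ T₀)
  have hflati : ∀ x : T₀.left, x = genericPoint T₀.left → Flat (T₀.left.fromSpecResidueField x) := by
    rintro x rfl
    exact Morphisms.flat_fromSpecResidueField_genericPoint _
  obtain ⟨Φ, hΦ, H⟩ := isPullback_lift_sliceProjection σ X₀ T₀ t e he₁ he₂ _ _ hfac
  obtain ⟨hflat, -⟩ := flat_surjective_of_isPullback_specMap (L := L)
    (Field.toIsField _) Φ ((baseChangeHom σ).obj X₀).hom _ _ H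
  haveI := hflat
  -- local Noetherianity
  haveI : LocallyOfFiniteType (snd X₀ T₀).left := by
    rw [Over.snd_left]; exact MorphismProperty.pullback_snd _ _ inferInstance
  haveI : IsLocallyNoetherian (pullback (snd X₀ T₀).left (T₀.left.fromSpecResidueField
      ((t.left ≫ baseChangeHomFst σ T₀) (IsLocalRing.closedPoint L)))) :=
    LocallyOfFiniteType.isLocallyNoetherian (pullback.snd (snd X₀ T₀).left _)
  haveI : LocallyOfFiniteType ((baseChangeHom σ).obj X₀).hom := by
    rw [baseChangeHom_obj_hom]; exact MorphismProperty.pullback_snd _ _ inferInstance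
  haveI : IsLocallyNoetherian ((baseChangeHom σ).obj X₀).left :=
    LocallyOfFiniteType.isLocallyNoetherian ((baseChangeHom σ).obj X₀).hom
  -- `η` is maximal in its `Φ`-fibre; the generic fibre inclusion preserves codimension
  have hpre : ((sliceAt ((baseChangeHom σ).obj X₀) t).left ≫ e.hom.left ≫
      baseChangeHomFst σ (X₀ ⊗ T₀)).base ⁻¹' Z = Φ.base ⁻¹' ((pullback.fst (snd X₀ T₀).left _).base ⁻¹' Z) := by
    rw [← hΦ]
    rfl
  have happ : ((sliceAt ((baseChangeHom σ).obj X₀) t).left ≫ e.hom.left ≫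
      baseChangeHomFst σ (X₀ ⊗ T₀)).base η = (pullback.fst (snd X₀ T₀).left _).base (Φ.base η) := by
    rw [← hΦ]
    rfl
  rw [hpre] at hη
  rw [happ, coheight_eq_coheight_apply_of_isGenericPoint_preimage Φ hη]
  refine @Motives.coheight_apply_of_flat_of_isPreimmersion _ _ (pullback.fst _ _)
    (MorphismProperty.pullback_fst _ _ (hflati _ ?_)) (MorphismProperty.pullback_fst _ _ inferInstance) _
  exact ht

end GenericFibre



/-! ### Descent of "smooth projective of dimension `n`" along a base field extension -/

section Descent

variable {K L : Type u} [Field K] [Field L] (σ : K →+* L)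

/-- **The relative dimension of a smooth `K`-scheme is read off after base change**: if
`X₀ → Spec K` is smooth and `X₀ ⊗_σ L → Spec L` is smooth of relative dimension `n`, then
`X₀ → Spec K` is smooth of relative dimension `n`. At each point `X₀ → Spec K` has a standard
smooth chart of SOME relative dimension `d` (`Motives.exists_appLE_isStandardSmoothOfRelativeDimension_of_mem_smoothLocus`);
its base change is a non-empty open of `X₀ ⊗_σ L` smooth of relative dimensions `d` and `n`, so
`d = n` (`Motives.SmoothSpread.eq_of_smoothOfRelativeDimension`); these charts cover `X₀`
(`Motives.smoothOfRelativeDimension_sSup_ι_comp`). [cite: StacksProject, Tag 02G2 and Tag 0C0C] -/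
theorem smoothOfRelativeDimension_hom_of_baseChangeHom {n : ℕ} (X₀ : SchemeOver K) [Smooth X₀.hom]
    [SmoothOfRelativeDimension n ((baseChangeHom σ).obj X₀).hom] :
    SmoothOfRelativeDimension n X₀.hom := by
  set X := (baseChangeHom σ).obj X₀ with hXdef
  set π := baseChangeHomFst σ X₀ with hπ
  have hsq : IsPullback π X.hom X₀.hom (Spec.map (CommRingCat.ofHom σ)) :=
    IsPullback.of_hasPullback X₀.hom (Spec.map (CommRingCat.ofHom σ))
  -- the opens on which `X₀ → Spec K` is smooth of relative dimension `n` cover `X₀`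
  set 𝒮 : Set X₀.left.Opens := {V | SmoothOfRelativeDimension n (V.ι ≫ X₀.hom)} with h𝒮
  have hcover : ∀ x₀ : X₀.left, ∃ V ∈ 𝒮, x₀ ∈ V := by
    intro x₀
    have hx₀ : x₀ ∈ X₀.hom.smoothLocus := by rw [Scheme.Hom.smoothLocus_eq_top]; trivial
    obtain ⟨d, U, V, hx₀V, e, h⟩ :=
      Motives.exists_appLE_isStandardSmoothOfRelativeDimension_of_mem_smoothLocus X₀.hom hx₀
    have hW : SmoothOfRelativeDimension d (V.1.ι ≫ X₀.hom) :=
      Motives.smoothOfRelativeDimension_ι_comp_of_appLE U V e h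
    -- base change the chart to `X₀ ⊗_σ L`: smooth of relative dimensions `d` and `n`
    have hsqV : IsPullback (π ∣_ V.1) ((π ⁻¹ᵁ V.1).ι ≫ X.hom) (V.1.ι ≫ X₀.hom)
        (Spec.map (CommRingCat.ofHom σ)) := (isPullback_morphismRestrict π V.1).paste_vert hsq
    have := smoothOfRelativeDimension_isStableUnderBaseChange (n := d)
    haveI hd : SmoothOfRelativeDimension d ((π ⁻¹ᵁ V.1).ι ≫ X.hom) :=
      MorphismProperty.of_isPullback hsqV hW
    haveI hn : SmoothOfRelativeDimension n ((π ⁻¹ᵁ V.1).ι ≫ X.hom) := by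
      have h0 : SmoothOfRelativeDimension (0 + n) ((π ⁻¹ᵁ V.1).ι ≫ X.hom) := inferInstance
      rwa [Nat.zero_add] at h0
    obtain ⟨x, hx⟩ := (HodgeTheory.surjective_baseChangeHomFst σ X₀).surj x₀
    have hxV : x ∈ π ⁻¹ᵁ V.1 := by
      change π.base x ∈ (V.1 : Set X₀.left)
      rw [hx]
      exact hx₀V
    have hdn : d = n := Motives.SmoothSpread.eq_of_smoothOfRelativeDimension ((π ⁻¹ᵁ V.1).ι ≫ X.hom) ⟨x, hxV⟩
    subst hdn
    exact ⟨V.1, hW, hx₀V⟩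
  have htop : sSup 𝒮 = ⊤ := top_le_iff.mp fun x₀ _ ↦ by
    obtain ⟨V, hV, hxV⟩ := hcover x₀
    rw [sSup_eq_iSup', TopologicalSpace.Opens.mem_iSup]
    exact ⟨⟨V, hV⟩, hxV⟩
  have hS := Motives.smoothOfRelativeDimension_sSup_ι_comp n X₀.hom 𝒮 fun V hV ↦ hV
  rw [htop] at hS
  haveI : IsIso (⊤ : X₀.left.Opens).ι := Scheme.topIso_hom X₀.left ▸ inferInstance
  exact (MorphismProperty.cancel_left_of_respectsIso (@SmoothOfRelativeDimension n) _ _).mp hS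

/-- Smoothness of `X₀ → Spec K` descends from `X₀ ⊗_σ L → Spec L` (fpqc descent along the
surjective flat quasi-compact `Spec L → Spec K`; EGA IV 17.7.3 (ii)). [folklore] -/
private theorem smooth_hom_of_baseChangeHom (X₀ : SchemeOver K)
    [Smooth ((baseChangeHom σ).obj X₀).hom] : Smooth X₀.hom := by
  haveI : Subsingleton ↥(Spec (CommRingCat.of K)) :=
    inferInstanceAs (Subsingleton (PrimeSpectrum K))
  haveI : Surjective (Spec.map (CommRingCat.ofHom σ)) :=
    ⟨fun x ↦ ⟨(default : ↥(Spec (CommRingCat.of L))), Subsingleton.elim _ _⟩⟩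
  have hQ : (@Surjective ⊓ @Flat ⊓ @QuasiCompact : MorphismProperty Scheme)
      (Spec.map (CommRingCat.ofHom σ)) := ⟨⟨‹_›, inferInstance⟩, inferInstance⟩
  exact MorphismProperty.of_isPullback_of_descendsAlong (P := @Smooth)
    (Q := @Surjective ⊓ @Flat ⊓ @QuasiCompact)
    (IsPullback.of_hasPullback X₀.hom (Spec.map (CommRingCat.ofHom σ))).flip hQ
    (show Smooth (pullback.snd X₀.hom (Spec.map (CommRingCat.ofHom σ))) from
      ‹Smooth ((baseChangeHom σ).obj X₀).hom›)

/-- **"Smooth projective of dimension `n`" descends along a base field extension**: for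
`σ : K →+* L` and a `K`-scheme `X₀`, if `X₀ ⊗_σ L` is smooth projective geometrically irreducible
of dimension `n` over `L`, then `X₀` is so over `K` (smoothness: fpqc descent; relative dimension:
`smoothOfRelativeDimension_hom_of_baseChangeHom`; projectivity: Görtz–Wedhorn I Prop. 14.57,
the tree's `Motives.IsProjectiveOver.of_baseChange_holds`; geometric irreducibility:
`geometricallyIrreducible_of_isPullback`). [cite: GortzWedhorn2020, Prop. 14.57 (p. 571)]
[cite: Hartshorne1977, III.10.1(b)] -/
theorem isSmoothProjective_of_baseChangeHom {n : ℕ} (X₀ : SchemeOver K)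
    (hX : IsSmoothProjective n ((baseChangeHom σ).obj X₀)) : IsSmoothProjective n X₀ := by
  letI := σ.toAlgebra
  haveI := hX.smoothOfRelativeDimension
  haveI : Smooth ((baseChangeHom σ).obj X₀).hom := SmoothOfRelativeDimension.smooth n _
  haveI : Smooth X₀.hom := smooth_hom_of_baseChangeHom σ X₀
  haveI := hX.geometricallyIrreducible
  have hsq : IsPullback (baseChangeHomFst σ X₀) ((baseChangeHom σ).obj X₀).hom X₀.hom
      (Spec.map (CommRingCat.ofHom (algebraMap K L))) :=
    IsPullback.of_hasPullback X₀.hom (Spec.map (CommRingCat.ofHom σ))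
  exact { smoothOfRelativeDimension := smoothOfRelativeDimension_hom_of_baseChangeHom σ X₀
          isProjectiveOver := Motives.IsProjectiveOver.of_baseChange_holds X₀ L hX.isProjectiveOver
          geometricallyIrreducible := SpreadingOutQbar.geometricallyIrreducible_of_isPullback hsq }

end Descent

end Literature.AlgebraicGeometry.HodgeTheory

end
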